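import Summits.Schanuel.Schanuel.Theses.TateNomes
import Summits.Schanuel.Schanuel.Theorems.TateNomesNomeTransferStubEnvelopeCount
import Summits.Schanuel.Schanuel.Theorems.TateNomesNomeTransferStubSpanDescent
import Summits.Schanuel.Schanuel.Theorems.TateNomesNomeTransferStubAlgPairCost
import HarnessLib

/-!
# Route `TateNomes`, crux `NomeTransfer` (item stmt-Schanuel-17405) — PROVED

Line `trdeg-bookkeeping` (crux-strategist skeleton `Cruxes/NomeTransfer/Lines/trdeg_bookkeeping.lean`,
lead prover-line-stmt-Schanuel-17405-0), composed BY NAME from the three landed stub files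
`TateNomesNomeTransferStubEnvelopeCount.lean` (`stub_envelopeCount`),
`TateNomesNomeTransferStubSpanDescent.lean` (`stub_spanDescent`) and
`TateNomesNomeTransferStubAlgPairCost.lean` (`stub_algPairCost`), all in this namespace.

TARGET (concluded by name): `Summit.Schanuel.Schanuel.Theses.TateNomes.NomeTransfer` — for
`z : Fin n → ℂ`, admissible `e : Fin k → ℂ` (each `eᵢ` or `exp eᵢ` algebraic over `ℚ`) and
`w : Fin (n+k) → ℂ` with `span_ℚ w = span_ℚ (z, e)`: if the envelope
`Env(w) = ℚ(w, e^w, P(e^{wⱼ}), Q(e^{wⱼ}), R(e^{wⱼ}))` has `trdeg ≥ 4(n+k)` then `n ≤ trdeg ℚ(z, e^z)`.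

PROOF (transcendence-degree bookkeeping in `IntermediateField ℚ ℂ`, no transcendence input).
Write `t = trdeg ℚ(z, e^z)`, `T_w = trdeg ℚ(w, e^w)`, `T_ze = trdeg ℚ(z, e, e^z, e^e)`. Then
`4(n+k) ≤ trdeg Env(w) ≤ T_w + 3(n+k)` (`stub_envelopeCount`: the `3(n+k)` modular values are opaque
generators), `T_w ≤ T_ze` (`stub_spanDescent`: `range w ⊆ span_ℚ (z, e)`, and `ℚ(S, e^S)` lies in the
relative algebraic closure of `ℚ(T, e^T)` when `S ⊆ span_ℚ T`), `T_ze ≤ t + k` (`stub_algPairCost`: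
each admissible pair has an algebraic member), so `4(n+k) ≤ t + k + 3(n+k)` in `Cardinal`; if
`t ≥ ℵ₀` the goal `n ≤ t` is free, else it is `ℕ`-arithmetic (`cancel`).  `LinearIndependent ℚ z`
and the `⊇` half of the span equality are not used (refuter crux-attack 2026-08-17: exactly
admissibility and the envelope bound are load-bearing).
-/

-- D-0017: the doubled `Schanuel.Schanuel` path component is the mandated summit/sub-problem namespace
set_option linter.dupNamespace false

namespace Summit.Schanuel.Schanuel.Theorems.TateNomesNomeTransfer

open Summit.Schanuel.Schanuel.Theses.TateNomes (NomeTransfer)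

/-- Cardinal cancellation used by the composition: from `4(n+k) ≤ t + k + 3(n+k)` conclude `n ≤ t`
(free if `t` is infinite, `ℕ`-arithmetic otherwise). [folklore] -/
theorem cancel {t : Cardinal} {n k : ℕ}
    (h : ((4 * (n + k) : ℕ) : Cardinal) ≤ t + (k : Cardinal) + ((3 * (n + k) : ℕ) : Cardinal)) :
    (n : Cardinal) ≤ t := by
  rcases lt_or_ge t Cardinal.aleph0 with ht | ht
  · obtain ⟨m, rfl⟩ := Cardinal.lt_aleph0.1 ht
    have h' : 4 * (n + k) ≤ m + k + 3 * (n + k) := by exact_mod_cast h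
    have hnm : n ≤ m := by omega
    exact_mod_cast hnm
  · exact (Cardinal.natCast_lt_aleph0 (n := n)).le.trans ht

/-- The pure bookkeeping behind the crux, with the four transcendence degrees abstracted:
envelope bound + the three stub inequalities give `n ≤ t`. [folklore] -/
theorem le_of_bounds {Tenv Tw Tze t : Cardinal} {n k : ℕ}
    (henv : ((4 * (n + k) : ℕ) : Cardinal) ≤ Tenv)
    (h₁ : Tenv ≤ Tw + ((3 * (n + k) : ℕ) : Cardinal)) (h₂ : Tw ≤ Tze)
    (h₃ : Tze ≤ t + (k : Cardinal)) : (n : Cardinal) ≤ t :=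
  cancel (henv.trans (h₁.trans (add_le_add (h₂.trans h₃) le_rfl)))

/-- **`NomeTransfer` (route `TateNomes`, item stmt-Schanuel-17405) holds** — concludes the route decl
`Summit.Schanuel.Schanuel.Theses.TateNomes.NomeTransfer` BY NAME from the three landed stubs
`stub_envelopeCount`, `stub_spanDescent`, `stub_algPairCost`. [folklore] -/
theorem NomeTransfer_of : NomeTransfer := by
  intro n z k e w _hz he hspan henv
  have hw : Set.range w ⊆ (Submodule.span ℚ (Set.range z ∪ Set.range e) : Set ℂ) := by
    intro x hx
    have hx' : x ∈ Submodule.span ℚ (Set.range w) := Submodule.subset_span hx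
    rw [hspan] at hx'
    exact hx'
  have h₂ := stub_spanDescent (n + k) n k w z e hw
  have h₃ := stub_algPairCost n k z e he
  exact le_of_bounds henv (stub_envelopeCount (n + k) _ _ _ _) h₂ h₃

end Summit.Schanuel.Schanuel.Theorems.TateNomesNomeTransfer
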